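import Mathlib
import Summits.AnomalousDissipation.AnomalousDissipation.Theorems.SoloBlindTailOperator
import Summits.AnomalousDissipation.AnomalousDissipation.Theorems.SoloBlindTailFold

/-!
# SoloBlind — the chain Green function: THE bounded solution of the semi-infinite chain, and its identification
# with the folded finite system (J-TAIL statement-layer glue)

The streak/roll chains of LEMMA P are semi-infinite tridiagonal systems
`a j · x (j-1) - β j · x j + c j · x (j+1) = r j` (`j ≥ 0`) whose right-hand sides are supported in the rows `≤ n`
(the FOLD ROW).  ENGINE L never sees the infinite system: it inverts the FOLDED finite matrix (rows `< n` unchanged,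
row `n` with `β n ↦ β n - c n · t (n+1)`), where the tail values `t k` come from the certified backward recursion
started at the seed `t K = tval` (`SoloBlindTailOperator`, `SoloBlindTailFold`).  This file supplies the object the
lemma talks about and the identification the engine relies on:

* `foldMap` — the folded finite system as a linear endomorphism of `Fin (n+1) → ℂ`; `foldMap_injective` (trivial
  folded kernel ⇒ injective) and `fold_solvable` (⇒ every right-hand side has a folded solution, by
  finite-dimensionality);
* `bounded_sol_exists` / `bounded_sol_unique` — under the fold hypotheses (dominant rows from the seed depth
  `K = n+L+1`, nonzero recursion denominators, trivial folded kernel) the infinite system with a right-hand side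
  supported in the rows `≤ n` has EXACTLY ONE bounded solution;
* `green` — that solution (the CHAIN GREEN FUNCTION applied to `r`), with `green_isSol`, `green_bounded`, `eq_green`
  (any bounded solution is `green`), and the READ-OUT IDENTITY `green_top` : on the rows `≤ n` it coincides with ANY
  solution of the folded finite system — so the Green entries the lemma needs are literally the entries of the folded
  inverse that the engine encloses.
-/

namespace Summit.AnomalousDissipation.SoloBlind.ChainGreen

open BoundedContinuousFunction Finset
open Summit.AnomalousDissipation.SoloBlind.TailOperator
open Summit.AnomalousDissipation.SoloBlind.TailFold

variable {a β c : ℕ → ℂ} {b q : ℝ} {n L : ℕ} {t : ℕ → ℂ}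

/-! ### The folded finite system as a linear map -/

/-- Extension by zero of a vector on the rows `≤ n` to a sequence. -/
def extN (n : ℕ) (w : Fin (n + 1) → ℂ) : ℕ → ℂ := fun j => if h : j < n + 1 then w ⟨j, h⟩ else 0

/-- `extN` on the rows `≤ n`. -/
theorem extN_of_lt (w : Fin (n + 1) → ℂ) {j : ℕ} (h : j < n + 1) : extN n w j = w ⟨j, h⟩ := by
  simp [extN, h]

/-- `extN` is additive. -/
theorem extN_add (u v : Fin (n + 1) → ℂ) (j : ℕ) : extN n (u + v) j = extN n u j + extN n v j := by
  unfold extN; split_ifs <;> simp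

/-- `extN` is homogeneous. -/
theorem extN_smul (s : ℂ) (u : Fin (n + 1) → ℂ) (j : ℕ) : extN n (s • u) j = s * extN n u j := by
  unfold extN; split_ifs <;> simp

/-- `prev` is additive. -/
theorem prev_add (y y' : ℕ → ℂ) (j : ℕ) : prev (fun i => y i + y' i) j = prev y j + prev y' j := by
  cases j <;> simp [prev]

/-- `prev` is homogeneous. -/
theorem prev_smul (s : ℂ) (y : ℕ → ℂ) (j : ℕ) : prev (fun i => s * y i) j = s * prev y j := by
  cases j <;> simp [prev]

/-- Row `j` of the folded system applied to a sequence `w`: the chain row for `j < n`, the folded row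
`a n · w (n-1) - (β n - c n · tn1) · w n` for `j = n` (and, irrelevantly, beyond). -/
def foldRow (a β c : ℕ → ℂ) (tn1 : ℂ) (n : ℕ) (w : ℕ → ℂ) (j : ℕ) : ℂ :=
  if j < n then a j * prev w j - β j * w j + c j * w (j + 1) else a j * prev w j - (β j - c j * tn1) * w j

/-- The folded finite system as a linear endomorphism of `Fin (n+1) → ℂ`. -/
noncomputable def foldMap (a β c : ℕ → ℂ) (tn1 : ℂ) (n : ℕ) : (Fin (n + 1) → ℂ) →ₗ[ℂ] (Fin (n + 1) → ℂ) where
  toFun w := fun j => foldRow a β c tn1 n (extN n w) j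
  map_add' u v := by
    funext j
    have hp : prev (extN n (u + v)) j = prev (extN n u) j + prev (extN n v) j := by
      rw [← prev_add]; congr 1; funext i; exact extN_add u v i
    simp only [foldRow, Pi.add_apply, hp, extN_add]
    split_ifs <;> ring
  map_smul' s u := by
    funext j
    have hp : prev (extN n (s • u)) j = s * prev (extN n u) j := by
      rw [← prev_smul]; congr 1; funext i; exact extN_smul s u i
    simp only [foldRow, Pi.smul_apply, hp, extN_smul, smul_eq_mul, RingHom.id_apply]
    split_ifs <;> ring

/-- Pointwise value of `foldMap`. -/
theorem foldMap_apply (tn1 : ℂ) (w : Fin (n + 1) → ℂ) (j : Fin (n + 1)) :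
    foldMap a β c tn1 n w j = foldRow a β c tn1 n (extN n w) j := rfl

/-- A trivial folded kernel (the hypothesis `hF` of `TailFold.fold_unique`) makes `foldMap` injective. -/
theorem foldMap_injective (tn1 : ℂ)
    (hF : ∀ w : ℕ → ℂ, (∀ j, j < n → a j * prev w j - β j * w j + c j * w (j + 1) = 0) →
      a n * prev w n - (β n - c n * tn1) * w n = 0 → ∀ j, j ≤ n → w j = 0) :
    Function.Injective (foldMap a β c tn1 n) := by
  rw [← LinearMap.ker_eq_bot, LinearMap.ker_eq_bot']
  intro w hw
  have hrow : ∀ j, j < n + 1 → foldRow a β c tn1 n (extN n w) j = 0 := fun j hj => by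
    have := congrArg (fun f => f ⟨j, hj⟩) hw
    simpa [foldMap_apply] using this
  have h1 : ∀ j, j < n → a j * prev (extN n w) j - β j * extN n w j + c j * extN n w (j + 1) = 0 := by
    intro j hj; have := hrow j (by omega); simpa [foldRow, hj] using this
  have h2 : a n * prev (extN n w) n - (β n - c n * tn1) * extN n w n = 0 := by
    have := hrow n (by omega); simpa [foldRow] using this
  have hz := hF (extN n w) h1 h2
  funext ⟨j, hj⟩
  have := hz j (by omega)
  rw [extN_of_lt w hj] at this
  simpa using this

/-- FOLDED SOLVABILITY: with a trivial folded kernel, every right-hand side on the rows `≤ n` has a folded solution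
(injective ⇒ surjective in finite dimensions). -/
theorem fold_solvable (tn1 : ℂ)
    (hF : ∀ w : ℕ → ℂ, (∀ j, j < n → a j * prev w j - β j * w j + c j * w (j + 1) = 0) →
      a n * prev w n - (β n - c n * tn1) * w n = 0 → ∀ j, j ≤ n → w j = 0)
    (r : ℕ → ℂ) :
    ∃ z : ℕ → ℂ, (∀ j, j < n → a j * prev z j - β j * z j + c j * z (j + 1) = r j) ∧
      a n * prev z n - (β n - c n * tn1) * z n = r n := by
  have hsurj : Function.Surjective (foldMap a β c tn1 n) :=
    LinearMap.injective_iff_surjective.mp (foldMap_injective tn1 hF)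
  obtain ⟨w, hw⟩ := hsurj (fun j : Fin (n + 1) => r j)
  refine ⟨extN n w, fun j hj => ?_, ?_⟩
  · have := congrArg (fun f => f ⟨j, by omega⟩) hw
    simpa [foldMap_apply, foldRow, hj] using this
  · have := congrArg (fun f => f ⟨n, by omega⟩) hw
    simpa [foldMap_apply, foldRow] using this

/-! ### The bounded solution of the infinite chain -/

section Fold

/-- The standing FOLD HYPOTHESES of a chain of ENGINE L: dominance of the rows from the seed depth `K = n+L+1`
(`hD`), the seed `t K = tval` (`htK`), the certified recursion with nonzero denominators (`hden`, `hrec`), and a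
trivial folded kernel (`hF`, which the engine certifies by enclosing the folded inverse). -/
structure FoldData (a β c : ℕ → ℂ) (t : ℕ → ℂ) (n L : ℕ) (b q : ℝ) : Prop where
  hD : Dominant (fun i => a (n + L + 1 + i)) (fun i => β (n + L + 1 + i)) (fun i => c (n + L + 1 + i)) b q
  htK : t (n + L + 1) = tval hD
  hden : ∀ k, n < k → k ≤ n + L → β k - c k * t (k + 1) ≠ 0
  hrec : ∀ k, n < k → k ≤ n + L → t k * (β k - c k * t (k + 1)) = a k
  hF : ∀ w : ℕ → ℂ, (∀ j, j < n → a j * prev w j - β j * w j + c j * w (j + 1) = 0) →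
      a n * prev w n - (β n - c n * t (n + 1)) * w n = 0 → ∀ j, j ≤ n → w j = 0

variable (hFD : FoldData a β c t n L b q)
include hFD

/-- From a folded solution `z` (right-hand side `r` supported in the rows `≤ n`), `xsol z t y (a K) n L` with `y` the
bounded tail solution for `δ₀` is a bounded solution of the infinite system with top block `z`. -/
theorem xsol_isSol_bounded {r z : ℕ → ℂ}
    (hz : ∀ j, j < n → a j * prev z j - β j * z j + c j * z (j + 1) = r j)
    (hzf : a n * prev z n - (β n - c n * t (n + 1)) * z n = r n) (hr : ∀ j, n < j → r j = 0) :
    IsSol a β c r (xsol z t (sol hFD.hD delta0) (a (n + L + 1)) n L) ∧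
      ∃ C, ∀ j, ‖xsol z t (sol hFD.hD delta0) (a (n + L + 1)) n L j‖ ≤ C := by
  refine ⟨?_, fold_bounded (B := ‖sol hFD.hD delta0‖) (fun i => (sol hFD.hD delta0).norm_coe_le_norm i)⟩
  refine fold_isSol hz hzf hr hFD.hrec rfl ?_ ?_
  · rw [hFD.htK, tval]
  · have h := isSol_sol hFD.hD delta0
    intro i; have := h i; simpa only [delta0_apply] using this

/-- EXISTENCE: the infinite chain with a right-hand side supported in the rows `≤ n` has a bounded solution, whose top
block solves the folded finite system. -/
theorem bounded_sol_exists {r : ℕ → ℂ} (hr : ∀ j, n < j → r j = 0) :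
    ∃ x : ℕ → ℂ, IsSol a β c r x ∧ (∃ C, ∀ j, ‖x j‖ ≤ C) ∧
      ∃ z : ℕ → ℂ, (∀ j, j < n → a j * prev z j - β j * z j + c j * z (j + 1) = r j) ∧
        a n * prev z n - (β n - c n * t (n + 1)) * z n = r n ∧ ∀ j, j ≤ n → x j = z j := by
  obtain ⟨z, hz, hzf⟩ := fold_solvable (a := a) (β := β) (c := c) (t (n + 1)) hFD.hF r
  obtain ⟨hS, hB⟩ := xsol_isSol_bounded hFD hz hzf hr
  exact ⟨_, hS, hB, z, hz, hzf, fun j hj => xsol_top hj⟩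

/-- UNIQUENESS: two bounded solutions of the infinite chain coincide (`TailFold.fold_unique`). -/
theorem bounded_sol_unique {r x x' : ℕ → ℂ} (hx : IsSol a β c r x) (hx' : IsSol a β c r x')
    {B B' : ℝ} (hB : ∀ j, ‖x j‖ ≤ B) (hB' : ∀ j, ‖x' j‖ ≤ B') : x = x' :=
  fold_unique hFD.hD hFD.htK hFD.hden hFD.hrec hFD.hF hx hx' hB hB'

/-- THE CHAIN GREEN FUNCTION applied to a right-hand side `r` supported in the rows `≤ n`: the bounded solution of
the infinite chain. -/
noncomputable def green {r : ℕ → ℂ} (hr : ∀ j, n < j → r j = 0) : ℕ → ℂ :=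
  Classical.choose (bounded_sol_exists hFD hr)

/-- `green r` solves the infinite chain. -/
theorem green_isSol {r : ℕ → ℂ} (hr : ∀ j, n < j → r j = 0) : IsSol a β c r (green hFD hr) :=
  (Classical.choose_spec (bounded_sol_exists hFD hr)).1

/-- `green r` is bounded. -/
theorem green_bounded {r : ℕ → ℂ} (hr : ∀ j, n < j → r j = 0) : ∃ C, ∀ j, ‖green hFD hr j‖ ≤ C :=
  (Classical.choose_spec (bounded_sol_exists hFD hr)).2.1

/-- Any bounded solution IS the Green function applied to `r`. -/
theorem eq_green {r x : ℕ → ℂ} (hr : ∀ j, n < j → r j = 0) (hx : IsSol a β c r x) {B : ℝ}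
    (hB : ∀ j, ‖x j‖ ≤ B) : x = green hFD hr := by
  obtain ⟨C, hC⟩ := green_bounded hFD hr
  exact bounded_sol_unique hFD hx (green_isSol hFD hr) hB hC

/-- READ-OUT IDENTITY: on the rows `≤ n` the Green function coincides with ANY solution `z` of the folded finite
system — the Green entries of the infinite chain are the entries of the folded inverse. -/
theorem green_top {r z : ℕ → ℂ} (hr : ∀ j, n < j → r j = 0)
    (hz : ∀ j, j < n → a j * prev z j - β j * z j + c j * z (j + 1) = r j)
    (hzf : a n * prev z n - (β n - c n * t (n + 1)) * z n = r n) {j : ℕ} (hj : j ≤ n) :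
    green hFD hr j = z j := by
  obtain ⟨hS, C, hC⟩ := xsol_isSol_bounded hFD hz hzf hr
  have h := eq_green hFD hr hS hC
  rw [← h]; exact xsol_top hj

/-- The folded finite system has exactly one solution on the rows `≤ n` for each right-hand side (existence:
`fold_solvable`; uniqueness: `hF`), and it is the top block of the Green function. -/
theorem fold_solution_unique {r z z' : ℕ → ℂ}
    (hz : ∀ j, j < n → a j * prev z j - β j * z j + c j * z (j + 1) = r j)
    (hzf : a n * prev z n - (β n - c n * t (n + 1)) * z n = r n)
    (hz' : ∀ j, j < n → a j * prev z' j - β j * z' j + c j * z' (j + 1) = r j)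
    (hzf' : a n * prev z' n - (β n - c n * t (n + 1)) * z' n = r n) {j : ℕ} (hj : j ≤ n) : z j = z' j := by
  have h1 : ∀ i, i < n → a i * prev (fun k => z k - z' k) i - β i * (z i - z' i) + c i * (z (i + 1) - z' (i + 1)) = 0 := by
    intro i hi; have e1 := hz i hi; have e2 := hz' i hi
    rw [← prev_sub]; linear_combination e1 - e2
  have h2 : a n * prev (fun k => z k - z' k) n - (β n - c n * t (n + 1)) * (z n - z' n) = 0 := by
    rw [← prev_sub]; linear_combination hzf - hzf'
  have := hFD.hF (fun k => z k - z' k) h1 h2 j hj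
  exact sub_eq_zero.mp this

end Fold

end Summit.AnomalousDissipation.SoloBlind.ChainGreen
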